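import Mathlib
import Literature.NumberTheory.LFunctions.Zhang2022.Section16Lemma162RFactor
import HarnessLib

/-!
# Zhang (2022) §16 Lemma 16.2 at the repaired normaliser (GAP row G-d57-1), part 5: the `β → 0` model of
# the Euler factor at `s = 1` — perturbation bounds

Topic `Literature/NumberTheory/LFunctions/Zhang2022` (Landau–Siegel audit tree; verdict-neutral).
Y. Zhang, *Discrete mean estimates and the Landau–Siegel zero*, arXiv:2211.02515v1 (2022)
[Zhang2022LandauSiegel] — **an unrefereed manuscript under adjudication; nothing here asserts or denies
its Theorems 1–2.** ZHANG-L WP16 block D, sub-leaf `Typed.Section16B.Lemma162R`, clause (iv) (Lemma 16.2,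
§16 p. 94: "`E₂ⱼ(1) = (6/π²)·φ(D)/(D𝔭)·∏_{p∣D} p/(p+1) + O(𝓛⁻⁸)`"; App. A p. 106 "a sketch only").
Theorems only; no definitions, no facts.

The Euler factor of `E₂ⱼ` at `s = 1` is `Φ_q(1) = N_q(q⁻¹)·Σ_e c_e q^{−e}` with data depending on the
unimodular numbers `w₁ = q^{−β₁}`, `w = q^{β_j}` (parts 1–3). This file compares every ingredient with its
value at `w₁ = w = 1` ("the `β → 0` model"), with errors linear in `δ_q = ‖q^{−β₁} − 1‖ + ‖q^{β_j} − 1‖`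
(`≤ (|b₁| + |b_j|) log q`):
* `‖F_q(d,l;1−β_j) − F⁰_q(l)‖ ≤ 5000·δ_q` where `F⁰_q(l) = (1−χ(q)/q)⁻¹(1 − 𝟙[q∤l]χ(q)/(q−1))`
  (`norm_calM2Factor_sub_model_le`);
* `‖ρ_q(d,l) − ρ⁰_q(l)‖ ≤ 9000·δ_q`, `ρ⁰_q(l) = 𝟙[q∣l](1 − χ(q)/(q−1))⁻¹ + 𝟙[q∤l]` (when `‖F_q(1,1)‖ ≥ 1/2`,
  `|M_q| ≥ 3/4`);
* `‖c_e − c⁰_e‖ ≤ 10⁷(e+1)⁴ δ_q` for the model coefficients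
  `c⁰_e = (ν∗χ)(q^e)·Σ_{a≤e} χ(q)^{e−a} ρ⁰_q(q^{e−a})`, and `‖Σ_e (c_e − c⁰_e) q^{−e}‖ ≤ 4·10¹⁰ δ_q/q`;
* `‖N_q(q⁻¹) − N⁰_q(q⁻¹)‖ ≤ 8 δ_q/q`.

## References

* Y. Zhang, arXiv:2211.02515v1 (2022), §16 Lemma 16.2 p. 94; App. A pp. 105–106.
  [cite: Zhang2022LandauSiegel, §16 Lemma 16.2 p.94]
-/

noncomputable section

open Complex Real Finset Filter Topology

namespace Literature.NumberTheory.LFunctions.Zhang2022.Lemma162R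

open Literature.NumberTheory.LFunctions.Zhang2022
open Literature.NumberTheory.LFunctions.Zhang2022.Skeleton
open Literature.NumberTheory.LFunctions.Zhang2022.Typed.Section16A
open Literature.NumberTheory.LFunctions.Zhang2022.Typed.Section16B
open Literature.NumberTheory.LFunctions.Zhang2022.AppendixA

/-! ## §1. Two Lipschitz estimates -/

section Lipschitz

/-- `(1−a)/((1−x)(1−vx))` is `72`-Lipschitz in `(a, x)` on `‖a‖, ‖x‖ ≤ 1/2` (`‖v‖ ≤ 1`). [folklore] -/
private theorem lipschitz_pref {a a' x x' v : ℂ} (ha : ‖a‖ ≤ 1 / 2) (_ha' : ‖a'‖ ≤ 1 / 2) (hx : ‖x‖ ≤ 1 / 2)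
    (hx' : ‖x'‖ ≤ 1 / 2) (hv : ‖v‖ ≤ 1) :
    ‖(1 - a) / ((1 - x) * (1 - v * x)) - (1 - a') / ((1 - x') * (1 - v * x'))‖ ≤ 72 * (‖a - a'‖ + ‖x - x'‖) := by
  have hvx : ‖v * x‖ ≤ 1 / 2 := by rw [norm_mul]; nlinarith [norm_nonneg v, norm_nonneg x]
  have hvx' : ‖v * x'‖ ≤ 1 / 2 := by rw [norm_mul]; nlinarith [norm_nonneg v, norm_nonneg x']
  have hl : ∀ z : ℂ, ‖z‖ ≤ 1 / 2 → 1 / 2 ≤ ‖1 - z‖ := fun z hz => by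
    have := norm_sub_norm_le (1 : ℂ) z; rw [norm_one] at this; linarith
  have h1 := hl x hx; have h2 := hl _ hvx; have h3 := hl x' hx'; have h4 := hl _ hvx'
  have hne : ∀ z : ℂ, ‖z‖ ≤ 1 / 2 → 1 - z ≠ 0 := fun z hz h0 => by
    have := hl z hz; rw [h0, norm_zero] at this; linarith
  set g : ℂ := 1 / ((1 - x) * (1 - v * x)) with hg
  set g' : ℂ := 1 / ((1 - x') * (1 - v * x')) with hg'
  have hgn : ‖g‖ ≤ 4 := by
    rw [hg, norm_div, norm_one, norm_mul, div_le_iff₀ (by nlinarith)]; nlinarith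
  have hgn' : ‖g'‖ ≤ 4 := by
    rw [hg', norm_div, norm_one, norm_mul, div_le_iff₀ (by nlinarith)]; nlinarith
  have hD : (1 - x) * (1 - v * x) ≠ 0 := mul_ne_zero (hne x hx) (hne _ hvx)
  have hD' : (1 - x') * (1 - v * x') ≠ 0 := mul_ne_zero (hne x' hx') (hne _ hvx')
  have hgg : g - g' = ((1 - x') * (1 - v * x') - (1 - x) * (1 - v * x)) * (g * g') := by
    rw [hg, hg', div_sub_div _ _ hD hD', one_div_mul_one_div, mul_one_div, one_mul, mul_one]
  have hnum : ‖(1 - x') * (1 - v * x') - (1 - x) * (1 - v * x)‖ ≤ 3 * ‖x - x'‖ := by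
    rw [show (1 - x') * (1 - v * x') - (1 - x) * (1 - v * x) = (x - x') * (1 + v - v * (x + x')) by ring, norm_mul]
    have : ‖1 + v - v * (x + x')‖ ≤ 3 := by
      calc _ ≤ ‖1 + v‖ + ‖v * (x + x')‖ := norm_sub_le _ _
        _ ≤ (‖(1 : ℂ)‖ + ‖v‖) + ‖v‖ * ‖x + x'‖ := by rw [← norm_mul]; exact add_le_add (norm_add_le _ _) le_rfl
        _ ≤ (1 + 1) + 1 * 1 := by
            rw [norm_one]
            gcongr
            · exact (norm_add_le x x').trans (by linarith)
        _ = 3 := by norm_num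
    nlinarith [norm_nonneg (x - x')]
  have hgd : ‖g - g'‖ ≤ 48 * ‖x - x'‖ := by
    rw [hgg, norm_mul, norm_mul]
    have hgg' : ‖g‖ * ‖g'‖ ≤ 16 := by
      calc ‖g‖ * ‖g'‖ ≤ 4 * 4 := mul_le_mul hgn hgn' (norm_nonneg _) (by norm_num)
        _ = 16 := by norm_num
    calc _ ≤ (3 * ‖x - x'‖) * 16 := mul_le_mul hnum hgg' (by positivity) (by positivity)
      _ = 48 * ‖x - x'‖ := by ring
  have e : (1 - a) / ((1 - x) * (1 - v * x)) - (1 - a') / ((1 - x') * (1 - v * x')) =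
      (1 - a) * (g - g') + (a' - a) * g' := by rw [hg, hg']; ring
  rw [e]
  have ha1 : ‖1 - a‖ ≤ 3 / 2 := (norm_sub_le _ _).trans (by rw [norm_one]; linarith)
  calc ‖(1 - a) * (g - g') + (a' - a) * g'‖ ≤ ‖1 - a‖ * ‖g - g'‖ + ‖a' - a‖ * ‖g'‖ := by
        rw [← norm_mul, ← norm_mul]; exact norm_add_le _ _
    _ ≤ (3 / 2) * (48 * ‖x - x'‖) + ‖a - a'‖ * 4 := by
        rw [norm_sub_rev a' a]
        gcongr
    _ ≤ 72 * (‖a - a'‖ + ‖x - x'‖) := by nlinarith [norm_nonneg (a - a'), norm_nonneg (x - x')]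

/-- `x(1−x)/(1−u)` is `4`-Lipschitz in `(x, u)` on `‖x‖, ‖u‖ ≤ 1/2`. [folklore] -/
private theorem lipschitz_ser {x x' u u' : ℂ} (hx : ‖x‖ ≤ 1 / 2) (hx' : ‖x'‖ ≤ 1 / 2) (hu : ‖u‖ ≤ 1 / 2)
    (hu' : ‖u'‖ ≤ 1 / 2) :
    ‖x * (1 - x) / (1 - u) - x' * (1 - x') / (1 - u')‖ ≤ 4 * (‖x - x'‖ + ‖u - u'‖) := by
  have hl : ∀ z : ℂ, ‖z‖ ≤ 1 / 2 → 1 / 2 ≤ ‖1 - z‖ := fun z hz => by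
    have := norm_sub_norm_le (1 : ℂ) z; rw [norm_one] at this; linarith
  have hne : ∀ z : ℂ, ‖z‖ ≤ 1 / 2 → 1 - z ≠ 0 := fun z hz h0 => by
    have := hl z hz; rw [h0, norm_zero] at this; linarith
  set k : ℂ := 1 / (1 - u) with hk
  set k' : ℂ := 1 / (1 - u') with hk'
  have hkn : ‖k'‖ ≤ 2 := by
    rw [hk', norm_div, norm_one, div_le_iff₀ (by linarith [hl u' hu'])]; nlinarith [hl u' hu']
  have hkn0 : ‖k‖ ≤ 2 := by
    rw [hk, norm_div, norm_one, div_le_iff₀ (by linarith [hl u hu])]; nlinarith [hl u hu]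
  have hkk : k - k' = (u - u') * (k * k') := by
    rw [hk, hk', div_sub_div _ _ (hne u hu) (hne u' hu'), one_div_mul_one_div, mul_one_div, one_mul, mul_one]
    ring
  have hkd : ‖k - k'‖ ≤ 4 * ‖u - u'‖ := by
    rw [hkk, norm_mul, norm_mul]
    have hkk' : ‖k‖ * ‖k'‖ ≤ 4 := by
      calc ‖k‖ * ‖k'‖ ≤ 2 * 2 := mul_le_mul hkn0 hkn (norm_nonneg _) (by norm_num)
        _ = 4 := by norm_num
    calc _ ≤ ‖u - u'‖ * 4 := mul_le_mul_of_nonneg_left hkk' (norm_nonneg _)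
      _ = 4 * ‖u - u'‖ := by ring
  have hxx : ‖x * (1 - x) - x' * (1 - x')‖ ≤ 2 * ‖x - x'‖ := by
    rw [show x * (1 - x) - x' * (1 - x') = (x - x') * (1 - x - x') by ring, norm_mul]
    have : ‖1 - x - x'‖ ≤ 2 := by
      calc _ ≤ ‖1 - x‖ + ‖x'‖ := norm_sub_le _ _
        _ ≤ (‖(1 : ℂ)‖ + ‖x‖) + ‖x'‖ := add_le_add (norm_sub_le _ _) le_rfl
        _ ≤ 2 := by rw [norm_one]; linarith
    nlinarith [norm_nonneg (x - x')]
  have hx1 : ‖x * (1 - x)‖ ≤ 3 / 4 := by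
    rw [norm_mul]
    have : ‖1 - x‖ ≤ 3 / 2 := (norm_sub_le _ _).trans (by rw [norm_one]; linarith)
    nlinarith [norm_nonneg x, norm_nonneg (1 - x)]
  have e : x * (1 - x) / (1 - u) - x' * (1 - x') / (1 - u') =
      x * (1 - x) * (k - k') + (x * (1 - x) - x' * (1 - x')) * k' := by rw [hk, hk']; ring
  rw [e]
  calc _ ≤ ‖x * (1 - x)‖ * ‖k - k'‖ + ‖x * (1 - x) - x' * (1 - x')‖ * ‖k'‖ := by
        rw [← norm_mul, ← norm_mul]; exact norm_add_le _ _
    _ ≤ (3 / 4) * (4 * ‖u - u'‖) + (2 * ‖x - x'‖) * 2 := by gcongr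
    _ ≤ 4 * (‖x - x'‖ + ‖u - u'‖) := by nlinarith [norm_nonneg (u - u'), norm_nonneg (x - x')]

/-- `‖w^a − 1‖ ≤ a‖w − 1‖` for `‖w‖ ≤ 1`. [folklore] -/
private theorem norm_pow_sub_one_le {w : ℂ} (hw : ‖w‖ ≤ 1) (a : ℕ) : ‖w ^ a - 1‖ ≤ a * ‖w - 1‖ := by
  induction a with
  | zero => simp
  | succ a ih =>
    rw [show w ^ (a + 1) - 1 = w * (w ^ a - 1) + (w - 1) by ring]
    calc _ ≤ ‖w‖ * ‖w ^ a - 1‖ + ‖w - 1‖ := by rw [← norm_mul]; exact norm_add_le _ _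
      _ ≤ 1 * (a * ‖w - 1‖) + ‖w - 1‖ := by gcongr
      _ = ((a + 1 : ℕ) : ℝ) * ‖w - 1‖ := by push_cast; ring

end Lipschitz

/-! ## §2. `F_q(d,l;1−β_j)` against its `β → 0` model -/

section FactorModel

/-- **Abstract core**: the closed form of `F_q(d,l;s)` — as a function of `w₁ = q^{−β₁}`, `x = q^{−s}`,
`L = λ̃₂` — is Lipschitz at the model point `(1, 1/q, 1)`:
`‖E(w₁,x,L) − E(1,1/q,1)‖ ≤ 5000·δ` when `‖x − 1/q‖ ≤ δ/q`, `‖w₁ − 1‖ ≤ δ`, `‖L − 1‖ ≤ 4δ`. [folklore] -/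
private theorem model_core {v w₁ x L cd el : ℂ} {q : ℕ} (hq : 2 ≤ q) {δ : ℝ} (hδ : 0 ≤ δ)
    (hv : ‖v‖ ≤ 1) (hxn : ‖x‖ = (q : ℝ)⁻¹) (hdx : ‖x - 1 / q‖ ≤ δ / q) (hw1n : ‖w₁‖ = 1)
    (hw1 : ‖w₁ - 1‖ ≤ δ) (hLn : ‖L‖ ≤ 3) (hL1 : ‖L - 1‖ ≤ 4 * δ) (hcd : ‖cd‖ ≤ 2) (hel : ‖el‖ ≤ 1) :
    ‖(1 - w₁ * x) / ((1 - x) * (1 - v * x)) *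
          (1 + L * (cd * (w₁ - 1) * x / (1 - w₁ * x) - el * (v * q / (q - 1)) * (x * (1 - x) / (1 - w₁ * x)))) -
        (1 - 1 * (1 / (q : ℂ))) / ((1 - 1 / (q : ℂ)) * (1 - v * (1 / (q : ℂ)))) *
          (1 + 1 * (cd * (1 - 1) * (1 / (q : ℂ)) / (1 - 1 * (1 / (q : ℂ))) -
            el * (v * q / (q - 1)) * (1 / (q : ℂ) * (1 - 1 / (q : ℂ)) / (1 - 1 * (1 / (q : ℂ))))))‖
      ≤ 5000 * δ := by
  have hq2 : (2 : ℝ) ≤ q := by exact_mod_cast hq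
  have hq0 : (0 : ℝ) < q := by linarith
  have hqinv : (q : ℝ)⁻¹ ≤ 1 / 2 := inv_le_of_inv_le₀ (by norm_num) (by linarith)
  have hq1' : ‖(1 : ℂ) / q‖ = (q : ℝ)⁻¹ := by rw [norm_div, norm_one, Complex.norm_natCast, one_div]
  have hxh : ‖x‖ ≤ 1 / 2 := by rw [hxn]; exact hqinv
  have hq1 : ‖(1 : ℂ) / q‖ ≤ 1 / 2 := by rw [hq1']; exact hqinv
  have hah : ‖w₁ * x‖ ≤ 1 / 2 := by rw [norm_mul, hw1n, one_mul]; exact hxh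
  have ha1h : ‖(1 : ℂ) * (1 / q)‖ ≤ 1 / 2 := by rw [one_mul]; exact hq1
  have hl : ∀ z : ℂ, ‖z‖ ≤ 1 / 2 → 1 / 2 ≤ ‖1 - z‖ := fun z hz => by
    have := norm_sub_norm_le (1 : ℂ) z; rw [norm_one] at this; linarith
  have hδq : δ / q ≤ δ / 2 := by
    rw [div_le_div_iff₀ hq0 (by norm_num)]; nlinarith
  -- distance of `a = w₁x` to `1/q`
  have hda : ‖w₁ * x - 1 * (1 / q)‖ ≤ 2 * δ := by
    rw [show w₁ * x - 1 * (1 / (q : ℂ)) = (w₁ - 1) * x + (x - 1 / q) by ring]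
    calc _ ≤ ‖(w₁ - 1) * x‖ + ‖x - 1 / q‖ := norm_add_le _ _
      _ ≤ δ * (1 / 2) + δ / q := by rw [norm_mul]; gcongr
      _ ≤ 2 * δ := by linarith
  -- the four blocks
  have hPP : ‖(1 - w₁ * x) / ((1 - x) * (1 - v * x)) - (1 - 1 * (1 / (q : ℂ))) / ((1 - 1 / (q : ℂ)) * (1 - v * (1 / (q : ℂ))))‖
      ≤ 72 * (2 * δ + δ / q) :=
    (lipschitz_pref hah ha1h hxh hq1 hv).trans (by gcongr)
  have hP0 : ‖(1 - 1 * (1 / (q : ℂ))) / ((1 - 1 / (q : ℂ)) * (1 - v * (1 / (q : ℂ))))‖ ≤ 6 := by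
    have hv1 : ‖v * (1 / (q : ℂ))‖ ≤ 1 / 2 := by rw [norm_mul]; nlinarith [norm_nonneg v, norm_nonneg ((1:ℂ)/q)]
    have h1 := hl _ hq1; have h2 := hl _ hv1
    rw [norm_div, norm_mul, div_le_iff₀ (by nlinarith)]
    have : ‖1 - 1 * (1 / (q : ℂ))‖ ≤ 3 / 2 := by
      rw [one_mul]; exact (norm_sub_le _ _).trans (by rw [norm_one]; linarith)
    have hprod : 1 / 4 ≤ ‖1 - 1 / (q : ℂ)‖ * ‖1 - v * (1 / (q : ℂ))‖ := by
      calc (1 : ℝ) / 4 = (1 / 2) * (1 / 2) := by norm_num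
        _ ≤ _ := mul_le_mul h1 h2 (by norm_num) (norm_nonneg _)
    linarith
  have h1a := hl _ hah
  have hXn : ‖cd * (w₁ - 1) * x / (1 - w₁ * x) - el * (v * q / (q - 1)) * (x * (1 - x) / (1 - w₁ * x))‖ ≤ 7 := by
    have hw12 : ‖w₁ - 1‖ ≤ 2 := (norm_sub_le _ _).trans (by rw [hw1n, norm_one]; norm_num)
    have t1 : ‖cd * (w₁ - 1) * x / (1 - w₁ * x)‖ ≤ 4 := by
      rw [norm_div, norm_mul, norm_mul, div_le_iff₀ (by linarith)]
      calc ‖cd‖ * ‖w₁ - 1‖ * ‖x‖ ≤ 2 * 2 * (1 / 2) := by gcongr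
        _ ≤ 4 * ‖1 - w₁ * x‖ := by linarith
    have hvq : ‖v * (q : ℂ) / ((q : ℂ) - 1)‖ ≤ 2 := by
      have hq1r : (q : ℝ) - 1 ≤ ‖(q : ℂ) - 1‖ := by
        have := norm_sub_norm_le (q : ℂ) 1; rw [Complex.norm_natCast, norm_one] at this; linarith
      rw [norm_div, norm_mul, Complex.norm_natCast, div_le_iff₀ (by linarith)]
      nlinarith [norm_nonneg v]
    have t2 : ‖el * (v * q / (q - 1)) * (x * (1 - x) / (1 - w₁ * x))‖ ≤ 3 := by
      have h1x : ‖1 - x‖ ≤ 3 / 2 := (norm_sub_le _ _).trans (by rw [norm_one]; linarith)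
      have hfrac : ‖x * (1 - x) / (1 - w₁ * x)‖ ≤ 3 / 2 := by
        rw [norm_div, norm_mul, div_le_iff₀ (by linarith)]
        calc ‖x‖ * ‖1 - x‖ ≤ (1 / 2) * (3 / 2) := by gcongr
          _ ≤ 3 / 2 * ‖1 - w₁ * x‖ := by linarith
      rw [norm_mul, norm_mul]
      calc ‖el‖ * ‖v * (q : ℂ) / ((q : ℂ) - 1)‖ * ‖x * (1 - x) / (1 - w₁ * x)‖ ≤ 1 * 2 * (3 / 2) := by gcongr
        _ = 3 := by norm_num
    exact (norm_sub_le _ _).trans (by linarith)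
  have hXX : ‖(cd * (w₁ - 1) * x / (1 - w₁ * x) - el * (v * q / (q - 1)) * (x * (1 - x) / (1 - w₁ * x))) -
      (cd * (1 - 1) * (1 / (q : ℂ)) / (1 - 1 * (1 / (q : ℂ))) -
        el * (v * q / (q - 1)) * (1 / (q : ℂ) * (1 - 1 / (q : ℂ)) / (1 - 1 * (1 / (q : ℂ)))))‖ ≤ 26 * δ := by
    rw [show (cd * (w₁ - 1) * x / (1 - w₁ * x) - el * (v * q / (q - 1)) * (x * (1 - x) / (1 - w₁ * x))) -
      (cd * (1 - 1) * (1 / (q : ℂ)) / (1 - 1 * (1 / (q : ℂ))) -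
        el * (v * q / (q - 1)) * (1 / (q : ℂ) * (1 - 1 / (q : ℂ)) / (1 - 1 * (1 / (q : ℂ))))) =
      cd * (w₁ - 1) * x / (1 - w₁ * x) -
        el * (v * q / (q - 1)) * (x * (1 - x) / (1 - w₁ * x) - 1 / (q : ℂ) * (1 - 1 / (q : ℂ)) / (1 - 1 * (1 / (q : ℂ)))) by ring]
    have t1 : ‖cd * (w₁ - 1) * x / (1 - w₁ * x)‖ ≤ 2 * δ := by
      rw [norm_div, norm_mul, norm_mul, div_le_iff₀ (by linarith)]
      calc ‖cd‖ * ‖w₁ - 1‖ * ‖x‖ ≤ 2 * δ * (1 / 2) := by gcongr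
        _ ≤ 2 * δ * ‖1 - w₁ * x‖ := mul_le_mul_of_nonneg_left h1a (by positivity)
    have hvq : ‖v * (q : ℂ) / ((q : ℂ) - 1)‖ ≤ 2 := by
      have hq1r : (q : ℝ) - 1 ≤ ‖(q : ℂ) - 1‖ := by
        have := norm_sub_norm_le (q : ℂ) 1; rw [Complex.norm_natCast, norm_one] at this; linarith
      rw [norm_div, norm_mul, Complex.norm_natCast, div_le_iff₀ (by linarith)]
      nlinarith [norm_nonneg v]
    have t2 : ‖x * (1 - x) / (1 - w₁ * x) - 1 / (q : ℂ) * (1 - 1 / (q : ℂ)) / (1 - 1 * (1 / (q : ℂ)))‖ ≤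
        4 * (δ / q + 2 * δ) := (lipschitz_ser hxh hq1 hah ha1h).trans (by gcongr)
    calc _ ≤ ‖cd * (w₁ - 1) * x / (1 - w₁ * x)‖ +
          ‖el * (v * q / (q - 1)) * (x * (1 - x) / (1 - w₁ * x) - 1 / (q : ℂ) * (1 - 1 / (q : ℂ)) / (1 - 1 * (1 / (q : ℂ))))‖ :=
          norm_sub_le _ _
      _ ≤ 2 * δ + 1 * 2 * (4 * (δ / q + 2 * δ)) := by rw [norm_mul, norm_mul]; gcongr
      _ ≤ 26 * δ := by linarith
  -- combine: E − E0 = (P − P0)(1 + L X) + P0((L − 1)X + (X − X0))   [X0-term has L0 = 1]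
  rw [show (1 - w₁ * x) / ((1 - x) * (1 - v * x)) *
          (1 + L * (cd * (w₁ - 1) * x / (1 - w₁ * x) - el * (v * q / (q - 1)) * (x * (1 - x) / (1 - w₁ * x)))) -
        (1 - 1 * (1 / (q : ℂ))) / ((1 - 1 / (q : ℂ)) * (1 - v * (1 / (q : ℂ)))) *
          (1 + 1 * (cd * (1 - 1) * (1 / (q : ℂ)) / (1 - 1 * (1 / (q : ℂ))) -
            el * (v * q / (q - 1)) * (1 / (q : ℂ) * (1 - 1 / (q : ℂ)) / (1 - 1 * (1 / (q : ℂ)))))) =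
      ((1 - w₁ * x) / ((1 - x) * (1 - v * x)) - (1 - 1 * (1 / (q : ℂ))) / ((1 - 1 / (q : ℂ)) * (1 - v * (1 / (q : ℂ))))) *
          (1 + L * (cd * (w₁ - 1) * x / (1 - w₁ * x) - el * (v * q / (q - 1)) * (x * (1 - x) / (1 - w₁ * x)))) +
        (1 - 1 * (1 / (q : ℂ))) / ((1 - 1 / (q : ℂ)) * (1 - v * (1 / (q : ℂ)))) *
          ((L - 1) * (cd * (w₁ - 1) * x / (1 - w₁ * x) - el * (v * q / (q - 1)) * (x * (1 - x) / (1 - w₁ * x))) +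
            ((cd * (w₁ - 1) * x / (1 - w₁ * x) - el * (v * q / (q - 1)) * (x * (1 - x) / (1 - w₁ * x))) -
              (cd * (1 - 1) * (1 / (q : ℂ)) / (1 - 1 * (1 / (q : ℂ))) -
                el * (v * q / (q - 1)) * (1 / (q : ℂ) * (1 - 1 / (q : ℂ)) / (1 - 1 * (1 / (q : ℂ))))))) by ring]
  have h1LX : ‖1 + L * (cd * (w₁ - 1) * x / (1 - w₁ * x) - el * (v * q / (q - 1)) * (x * (1 - x) / (1 - w₁ * x)))‖ ≤ 22 := by
    calc _ ≤ ‖(1 : ℂ)‖ + ‖L * (cd * (w₁ - 1) * x / (1 - w₁ * x) - el * (v * q / (q - 1)) * (x * (1 - x) / (1 - w₁ * x)))‖ :=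
          norm_add_le _ _
      _ ≤ 1 + 3 * 7 := by rw [norm_one, norm_mul]; gcongr
      _ = 22 := by norm_num
  calc _ ≤ ‖(1 - w₁ * x) / ((1 - x) * (1 - v * x)) - (1 - 1 * (1 / (q : ℂ))) / ((1 - 1 / (q : ℂ)) * (1 - v * (1 / (q : ℂ))))‖ *
          ‖1 + L * (cd * (w₁ - 1) * x / (1 - w₁ * x) - el * (v * q / (q - 1)) * (x * (1 - x) / (1 - w₁ * x)))‖ +
        ‖(1 - 1 * (1 / (q : ℂ))) / ((1 - 1 / (q : ℂ)) * (1 - v * (1 / (q : ℂ))))‖ *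
          (‖L - 1‖ * ‖cd * (w₁ - 1) * x / (1 - w₁ * x) - el * (v * q / (q - 1)) * (x * (1 - x) / (1 - w₁ * x))‖ +
            ‖(cd * (w₁ - 1) * x / (1 - w₁ * x) - el * (v * q / (q - 1)) * (x * (1 - x) / (1 - w₁ * x))) -
              (cd * (1 - 1) * (1 / (q : ℂ)) / (1 - 1 * (1 / (q : ℂ))) -
                el * (v * q / (q - 1)) * (1 / (q : ℂ) * (1 - 1 / (q : ℂ)) / (1 - 1 * (1 / (q : ℂ)))))‖) := by
        refine (norm_add_le _ _).trans (add_le_add ?_ ?_)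
        · rw [norm_mul]
        · rw [norm_mul]
          gcongr
          exact (norm_add_le _ _).trans (by rw [norm_mul])
    _ ≤ (72 * (2 * δ + δ / q)) * 22 + 6 * ((4 * δ) * 7 + 26 * δ) := by gcongr
    _ ≤ 5000 * δ := by linarith

variable (c' : ℝ) {D : ℕ} (χ : DirichletCharacter ℂ D) (j : ℕ)

/-- The model value simplifies: `E(1, 1/q, 1) = (1 − χ(q)/q)⁻¹(1 − 𝟙[q∤l]χ(q)/(q−1))`. [folklore] -/
private theorem model_value_eq {v cd el : ℂ} {q : ℕ} (hq : 2 ≤ q) (hv : ‖v‖ ≤ 1) :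
    (1 - 1 * (1 / (q : ℂ))) / ((1 - 1 / (q : ℂ)) * (1 - v * (1 / (q : ℂ)))) *
          (1 + 1 * (cd * (1 - 1) * (1 / (q : ℂ)) / (1 - 1 * (1 / (q : ℂ))) -
            el * (v * q / (q - 1)) * (1 / (q : ℂ) * (1 - 1 / (q : ℂ)) / (1 - 1 * (1 / (q : ℂ)))))) =
      (1 - v / q)⁻¹ * (1 - el * (v / ((q : ℂ) - 1))) := by
  have hq2 : (2 : ℝ) ≤ q := by exact_mod_cast hq
  have hqC : (q : ℂ) ≠ 0 := by exact_mod_cast (show q ≠ 0 by omega)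
  have hq1 : (q : ℂ) - 1 ≠ 0 := by
    intro h; have := congrArg Complex.re h; simp at this; linarith
  have h1q : (1 : ℂ) - 1 / q ≠ 0 := by
    rw [sub_ne_zero]; intro h
    have := congrArg norm h; rw [norm_one, norm_div, norm_one, Complex.norm_natCast] at this
    have : (q : ℝ) = 1 := by
      have hq0 : (0:ℝ) < q := by linarith
      field_simp at this; linarith
    linarith
  have hvq : (1 : ℂ) - v / q ≠ 0 := by
    intro h
    have : ‖v / (q : ℂ)‖ = 1 := by rw [show v / (q : ℂ) = 1 from by linear_combination -h]; simp
    rw [norm_div, Complex.norm_natCast, div_eq_one_iff_eq (by linarith)] at this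
    linarith
  field_simp
  ring

/-- **`F_q(d,l;1−β_j)` is within `5000·δ_q` of its `β → 0` model `(1−χ(q)/q)⁻¹(1 − 𝟙[q∤l]χ(q)/(q−1))`**,
`δ_q = ‖q^{−β₁} − 1‖ + ‖q^{β_j} − 1‖` (prefactor, `λ̃₂` and local series are Lipschitz in `(q^{−β₁}, q^{β_j})`).
[cite: Zhang2022LandauSiegel, §16 p.93, App. A p.105] -/
theorem norm_calM2Factor_sub_model_le {q : ℕ} (hq : q.Prime) (d l : ℕ) :
    ‖calM2Factor c' χ q d l (1 - betaJ c' D j) -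
        (1 - χ (q : ZMod D) / q)⁻¹ * (1 - (if Nat.Coprime q l then (1 : ℂ) else 0) * (χ (q : ZMod D) / ((q : ℂ) - 1)))‖
      ≤ 5000 * (‖(q : ℂ) ^ (-beta1 c' D) - 1‖ + ‖(q : ℂ) ^ betaJ c' D j - 1‖) := by
  have hq2 : (2 : ℝ) ≤ q := by exact_mod_cast hq.two_le
  have hq0 : (0 : ℝ) < q := by linarith
  have hqC : (q : ℂ) ≠ 0 := by exact_mod_cast hq.ne_zero
  obtain ⟨hxn, -⟩ := norm_cpow_neg_betaJ c' (D := D) hq j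
  have hx1 : ‖(q : ℂ) ^ (-(1 - betaJ c' D j))‖ < 1 := by
    rw [hxn]; exact inv_lt_one_of_one_lt₀ (by exact_mod_cast hq.one_lt)
  obtain ⟨hw1n, hw1b⟩ := norm_cpow_neg_beta1 c' (D := D) hq.pos
  have hv : ‖χ (q : ZMod D)‖ ≤ 1 := χ.norm_le_one _
  -- split the exponent `−(s₀ + β₁)`
  have hsplit : (q : ℂ) ^ (-((1 - betaJ c' D j) + beta1 c' D)) =
      (q : ℂ) ^ (-beta1 c' D) * (q : ℂ) ^ (-(1 - betaJ c' D j)) := by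
    rw [show -((1 - betaJ c' D j) + beta1 c' D) = -beta1 c' D + -(1 - betaJ c' D j) by ring, Complex.cpow_add _ _ hqC]
  -- `x = q^{β_j}/q`: distance to `1/q`
  have hx : (q : ℂ) ^ (-(1 - betaJ c' D j)) = (q : ℂ) ^ betaJ c' D j / q := by
    rw [show -(1 - betaJ c' D j) = betaJ c' D j - 1 by ring, Complex.cpow_sub _ _ hqC, Complex.cpow_one]
  have hdx : ‖(q : ℂ) ^ (-(1 - betaJ c' D j)) - 1 / q‖ ≤
      (‖(q : ℂ) ^ (-beta1 c' D) - 1‖ + ‖(q : ℂ) ^ betaJ c' D j - 1‖) / q := by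
    rw [hx, show (q : ℂ) ^ betaJ c' D j / q - 1 / q = ((q : ℂ) ^ betaJ c' D j - 1) / q by ring, norm_div,
      Complex.norm_natCast]
    gcongr
    linarith [norm_nonneg ((q : ℂ) ^ (-beta1 c' D) - 1)]
  have hδ0 : 0 ≤ ‖(q : ℂ) ^ (-beta1 c' D) - 1‖ + ‖(q : ℂ) ^ betaJ c' D j - 1‖ := by positivity
  -- the pieces `L`, `cd`, `el`
  have hLn : ‖(if Nat.Coprime q d then locLam (χ (q : ZMod D)) ((q : ℂ) ^ (-beta1 c' D)) q else 1)‖ ≤ 3 := by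
    have := norm_lamTilde2_le c' χ hq d
    rw [lamTilde2_prime c' χ hq d] at this
    exact this
  have hL1 : ‖(if Nat.Coprime q d then locLam (χ (q : ZMod D)) ((q : ℂ) ^ (-beta1 c' D)) q else 1) - 1‖ ≤
      4 * (‖(q : ℂ) ^ (-beta1 c' D) - 1‖ + ‖(q : ℂ) ^ betaJ c' D j - 1‖) := by
    split_ifs
    · unfold locLam
      have hden : 1 / 2 ≤ ‖1 - χ (q : ZMod D) / (q : ℂ)‖ := by
        have h := norm_sub_norm_le (1 : ℂ) (χ (q : ZMod D) / q)
        rw [norm_one, norm_div, Complex.norm_natCast] at h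
        have : ‖χ (q : ZMod D)‖ / q ≤ 1 / 2 := by rw [div_le_iff₀ hq0]; nlinarith
        linarith
      have hden0 : 1 - χ (q : ZMod D) / (q : ℂ) ≠ 0 := by
        intro h; rw [h, norm_zero] at hden; linarith
      rw [div_sub_one hden0, norm_div, show 1 - χ (q : ZMod D) * (q : ℂ) ^ (-beta1 c' D) / (q : ℂ) -
        (1 - χ (q : ZMod D) / q) = χ (q : ZMod D) * (1 - (q : ℂ) ^ (-beta1 c' D)) / q by ring,
        div_le_iff₀ (by linarith), norm_div, norm_mul, Complex.norm_natCast, norm_sub_rev]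
      calc ‖χ (q : ZMod D)‖ * ‖(q : ℂ) ^ (-beta1 c' D) - 1‖ / q
          ≤ 1 * (‖(q : ℂ) ^ (-beta1 c' D) - 1‖ + ‖(q : ℂ) ^ betaJ c' D j - 1‖) / 2 := by
            rw [div_le_div_iff₀ hq0 (by norm_num)]
            have := norm_nonneg ((q : ℂ) ^ betaJ c' D j - 1)
            have := norm_nonneg ((q : ℂ) ^ (-beta1 c' D) - 1)
            nlinarith [norm_nonneg (χ (q : ZMod D))]
        _ ≤ _ := by nlinarith
    · simp; positivity
  have hcdn : ‖(if Nat.Coprime q d then (1 - (q : ℂ) ^ (-beta1 c' D) * (χ (q : ZMod D) / q))⁻¹ else (1 : ℂ))‖ ≤ 2 := by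
    split_ifs
    · have h1 : ‖(q : ℂ) ^ (-beta1 c' D) * (χ (q : ZMod D) / q)‖ ≤ 1 / 2 := by
        rw [norm_mul, hw1n, one_mul, norm_div, Complex.norm_natCast]
        calc ‖χ (q : ZMod D)‖ / q ≤ 1 / q := by gcongr
          _ ≤ 1 / 2 := one_div_le_one_div_of_le (by norm_num) hq2
      have h2 : 1 / 2 ≤ ‖1 - (q : ℂ) ^ (-beta1 c' D) * (χ (q : ZMod D) / q)‖ := by
        have := norm_sub_norm_le (1 : ℂ) ((q : ℂ) ^ (-beta1 c' D) * (χ (q : ZMod D) / q)); rw [norm_one] at this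
        linarith
      rw [norm_inv]; exact inv_le_of_inv_le₀ (by norm_num) (by linarith)
    · rw [norm_one]; norm_num
  have heln : ‖(if Nat.Coprime q l then (1 : ℂ) else 0)‖ ≤ 1 := by split_ifs <;> simp
  rw [calM2Factor, lamTilde2_prime c' χ hq d, xi2LocalSeries_prime c' χ hq d l _ hx1, hsplit,
    ← model_value_eq (cd := (if Nat.Coprime q d then (1 - (q : ℂ) ^ (-beta1 c' D) * (χ (q : ZMod D) / q))⁻¹ else (1 : ℂ)))
      hq.two_le hv]
  exact model_core hq.two_le hδ0 hv hxn hdx hw1n (by linarith [norm_nonneg ((q : ℂ) ^ betaJ c' D j - 1)])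
    hLn hL1 hcdn heln

end FactorModel

/-! ## §3. `ρ`, `λ₂` and the main term `M_q` -/

section RatioModel

variable (c' : ℝ) {D : ℕ} (χ : DirichletCharacter ℂ D) (j : ℕ)

/-- **`|M_q| ≥ 3/4`** for the main term `M_q = (1−χ(q)/(q−1))/(1−χ(q)/q)` of a real character at a prime,
except at `q = 2` with `χ(2) = 1` (where `M₂ = 0`). [cite: Zhang2022LandauSiegel, §16 Lemma 16.1 p.92] -/
theorem norm_locMain_ge {v : ℂ} {q : ℕ} (hq : q.Prime) (hv : v = 0 ∨ v = 1 ∨ v = -1) (h2 : q = 2 → v ≠ 1) :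
    3 / 4 ≤ ‖locMain v q‖ := by
  have hq2 : (2 : ℝ) ≤ q := by exact_mod_cast hq.two_le
  have hq0 : (0 : ℝ) < q := by linarith
  unfold locMain
  rcases hv with h0 | h1 | hm1
  · rw [h0]; norm_num
  · have hne : q ≠ 2 := fun h => h2 h h1
    have hq3 : (3 : ℝ) ≤ q := by
      have := hq.two_le
      exact_mod_cast (show 3 ≤ q by omega)
    rw [h1]
    have e : (1 - 1 / ((q : ℂ) - 1)) / (1 - 1 / (q : ℂ)) = (((q : ℝ) - 2) * q / ((q - 1) * (q - 1)) : ℝ) := by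
      have hq1 : (q : ℂ) - 1 ≠ 0 := by
        intro h; have := congrArg Complex.re h; simp at this; linarith
      have hqC : (q : ℂ) ≠ 0 := by exact_mod_cast hq.ne_zero
      push_cast
      field_simp
      ring
    have hnn : 0 ≤ ((q : ℝ) - 2) * q / ((q - 1) * (q - 1)) :=
      div_nonneg (mul_nonneg (by linarith) hq0.le) (mul_nonneg (by linarith) (by linarith))
    rw [e, Complex.norm_real, Real.norm_eq_abs, abs_of_nonneg hnn, le_div_iff₀ (by nlinarith)]
    nlinarith
  · rw [hm1]
    have e : (1 - (-1) / ((q : ℂ) - 1)) / (1 - (-1) / (q : ℂ)) = (((q : ℝ) * q) / ((q - 1) * (q + 1)) : ℝ) := by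
      have hq1 : (q : ℂ) - 1 ≠ 0 := by
        intro h; have := congrArg Complex.re h; simp at this; linarith
      have hqC : (q : ℂ) ≠ 0 := by exact_mod_cast hq.ne_zero
      push_cast
      field_simp
      ring
    have hnn : 0 ≤ ((q : ℝ) * q) / ((q - 1) * (q + 1)) :=
      div_nonneg (mul_nonneg hq0.le hq0.le) (mul_nonneg (by linarith) (by linarith))
    rw [e, Complex.norm_real, Real.norm_eq_abs, abs_of_nonneg hnn, le_div_iff₀ (by nlinarith)]
    nlinarith

/-- The model factor `(1−v/q)⁻¹(1 − ε·v/(q−1))` has norm `≤ 4` (`‖v‖ ≤ 1`, `‖ε‖ ≤ 1`, `q ≥ 2`), and for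
`ε = 1` it is `M_q`. [cite: Zhang2022LandauSiegel, §16 Lemma 16.1 p.92] -/
theorem norm_model_le {v el : ℂ} {q : ℕ} (hq : q.Prime) (hv : ‖v‖ ≤ 1) (hel : ‖el‖ ≤ 1) :
    ‖(1 - v / (q : ℂ))⁻¹ * (1 - el * (v / ((q : ℂ) - 1)))‖ ≤ 4 ∧
      (1 - v / (q : ℂ))⁻¹ * (1 - 1 * (v / ((q : ℂ) - 1))) = locMain v q := by
  have hq2 : (2 : ℝ) ≤ q := by exact_mod_cast hq.two_le
  have hq0 : (0 : ℝ) < q := by linarith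
  constructor
  · have hden : 1 / 2 ≤ ‖1 - v / (q : ℂ)‖ := by
      have h := norm_sub_norm_le (1 : ℂ) (v / q)
      rw [norm_one, norm_div, Complex.norm_natCast] at h
      have : ‖v‖ / q ≤ 1 / 2 := by rw [div_le_iff₀ hq0]; nlinarith
      linarith
    have h1 : ‖(1 - v / (q : ℂ))⁻¹‖ ≤ 2 := by rw [norm_inv]; exact inv_le_of_inv_le₀ (by norm_num) (by linarith)
    have hq1r : 1 ≤ ‖(q : ℂ) - 1‖ := by
      have := norm_sub_norm_le (q : ℂ) 1; rw [Complex.norm_natCast, norm_one] at this; linarith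
    have h2 : ‖1 - el * (v / ((q : ℂ) - 1))‖ ≤ 2 := by
      calc _ ≤ ‖(1 : ℂ)‖ + ‖el * (v / ((q : ℂ) - 1))‖ := norm_sub_le _ _
        _ ≤ 1 + 1 := by
            rw [norm_one, norm_mul, norm_div]
            gcongr
            calc ‖el‖ * (‖v‖ / ‖(q : ℂ) - 1‖) ≤ 1 * (1 / 1) := by gcongr
              _ = 1 := by norm_num
        _ = 2 := by norm_num
    rw [norm_mul]; nlinarith [norm_nonneg ((1 - v / (q : ℂ))⁻¹), norm_nonneg (1 - el * (v / ((q : ℂ) - 1)))]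
  · unfold locMain; rw [one_mul, div_eq_mul_inv v (q : ℂ), mul_comm, ← div_eq_mul_inv]

/-- **`ρ_q(d,l) = F_q(d,l)/F_q(1,1)` against its model `ρ⁰ = 𝟙[q∤l] + 𝟙[q∣l]·(1 − χ(q)/(q−1))⁻¹`**:
`‖ρ − ρ⁰‖ ≤ 110000·δ_q` when `‖F_q(1,1;1−β_j)‖ ≥ 1/2`, `χ(q) ∈ {0,±1}` and not (`q = 2`, `χ(2) = 1`).
[cite: Zhang2022LandauSiegel, §16 p.93, App. A p.105] -/
theorem norm_locRatio_sub_model_le {q : ℕ} (hq : q.Prime)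
    (hv : χ (q : ZMod D) = 0 ∨ χ (q : ZMod D) = 1 ∨ χ (q : ZMod D) = -1) (h2 : q = 2 → χ (2 : ZMod D) ≠ 1)
    (hF : 1 / 2 ≤ ‖calM2Factor c' χ q 1 1 (1 - betaJ c' D j)‖) (d l : ℕ) :
    ‖locRatio c' χ q d l (1 - betaJ c' D j) -
        (1 - (if Nat.Coprime q l then (1 : ℂ) else 0) * (χ (q : ZMod D) / ((q : ℂ) - 1))) /
          (1 - 1 * (χ (q : ZMod D) / ((q : ℂ) - 1)))‖
      ≤ 110000 * (‖(q : ℂ) ^ (-beta1 c' D) - 1‖ + ‖(q : ℂ) ^ betaJ c' D j - 1‖) := by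
  set v : ℂ := χ (q : ZMod D) with hvdef
  set δ : ℝ := ‖(q : ℂ) ^ (-beta1 c' D) - 1‖ + ‖(q : ℂ) ^ betaJ c' D j - 1‖ with hδ
  have hδ0 : 0 ≤ δ := by positivity
  have hvn : ‖v‖ ≤ 1 := χ.norm_le_one _
  have h2' : q = 2 → v ≠ 1 := by intro h; rw [hvdef, h]; simpa using h2 h
  set P0 : ℂ := (1 - v / (q : ℂ))⁻¹ with hP0
  set el : ℂ := (if Nat.Coprime q l then (1 : ℂ) else 0) with hel
  have heln : ‖el‖ ≤ 1 := by rw [hel]; split_ifs <;> simp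
  set Fdl := calM2Factor c' χ q d l (1 - betaJ c' D j) with hFdl
  set F11 := calM2Factor c' χ q 1 1 (1 - betaJ c' D j) with hF11
  set G : ℂ := P0 * (1 - el * (v / ((q : ℂ) - 1))) with hG
  set G1 : ℂ := P0 * (1 - 1 * (v / ((q : ℂ) - 1))) with hG1
  have hA : ‖Fdl - G‖ ≤ 5000 * δ := norm_calM2Factor_sub_model_le c' χ j hq d l
  have hB : ‖F11 - G1‖ ≤ 5000 * δ := by
    have := norm_calM2Factor_sub_model_le c' χ j hq 1 1
    rw [if_pos (Nat.coprime_one_right q)] at this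
    exact this
  have hGn : ‖G‖ ≤ 4 := (norm_model_le (el := el) hq hvn heln).1
  have hG1n : ‖G1‖ ≤ 4 := (norm_model_le (el := 1) hq hvn (by simp)).1
  have hG1M : G1 = locMain v q := (norm_model_le (el := 1) hq hvn (by simp)).2
  have hG1ge : 3 / 4 ≤ ‖G1‖ := by rw [hG1M]; exact norm_locMain_ge hq hv h2'
  have hF0 : F11 ≠ 0 := by intro h; rw [h, norm_zero] at hF; linarith
  have hG10 : G1 ≠ 0 := by intro h; rw [h, norm_zero] at hG1ge; linarith
  have hP00 : P0 ≠ 0 := by intro h; apply hG10; rw [hG1, h, zero_mul]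
  -- the model ratio equals G/G1
  have hratio : (1 - el * (v / ((q : ℂ) - 1))) / (1 - 1 * (v / ((q : ℂ) - 1))) = G / G1 := by
    rw [hG, hG1, mul_div_mul_left _ _ hP00]
  unfold locRatio
  rw [← hFdl, ← hF11, hratio, div_sub_div _ _ hF0 hG10, norm_div, norm_mul]
  have hnum : ‖Fdl * G1 - F11 * G‖ ≤ 40000 * δ := by
    rw [show Fdl * G1 - F11 * G = (Fdl - G) * G1 + G * (G1 - F11) by ring]
    calc _ ≤ ‖Fdl - G‖ * ‖G1‖ + ‖G‖ * ‖G1 - F11‖ := by rw [← norm_mul, ← norm_mul]; exact norm_add_le _ _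
      _ ≤ (5000 * δ) * 4 + 4 * (5000 * δ) := by rw [norm_sub_rev G1 F11]; gcongr
      _ = 40000 * δ := by ring
  have hden : 3 / 8 ≤ ‖F11‖ * ‖G1‖ := by nlinarith
  rw [div_le_iff₀ (by linarith)]
  nlinarith

/-- **`‖λ₂(q,1) − 1‖ ≤ 2‖q^{−β₁} − 1‖/q`** (`λ₂(q,1) − 1 = χ(q)q⁻¹(1 − q^{−β₁})/(1 − χ(q)q⁻¹)`).
[cite: Zhang2022LandauSiegel, §16 p.90 (u014)] -/
theorem norm_lam2_one_sub_one_le' {q : ℕ} (hq : q.Prime) :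
    ‖lam2 c' χ q 1 - 1‖ ≤ 2 * ‖(q : ℂ) ^ (-beta1 c' D) - 1‖ / q := by
  have hq2 : (2 : ℝ) ≤ q := by exact_mod_cast hq.two_le
  have hq0 : (0 : ℝ) < q := by linarith
  have hqC : (q : ℂ) ≠ 0 := by exact_mod_cast hq.ne_zero
  rw [Typed.Section16ALeaves.lam2_prime c' χ hq 1]
  set v : ℂ := χ (q : ZMod D) with hvdef
  set w₁ : ℂ := (q : ℂ) ^ (-beta1 c' D) with hw1
  have hv : ‖v‖ ≤ 1 := χ.norm_le_one _
  have hsplit : (q : ℂ) ^ (-((1 : ℂ) + beta1 c' D)) = (q : ℂ) ^ (-(1 : ℂ)) * w₁ := by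
    rw [show -((1 : ℂ) + beta1 c' D) = -(1 : ℂ) + -beta1 c' D by ring, Complex.cpow_add _ _ hqC]
  have hb : ‖(q : ℂ) ^ (-(1 : ℂ))‖ = (q : ℝ)⁻¹ := by
    rw [Complex.norm_natCast_cpow_of_pos hq.pos]; simp [Real.rpow_neg_one]
  have hqinv : (q : ℝ)⁻¹ ≤ 1 / 2 := inv_le_of_inv_le₀ (by norm_num) (by linarith)
  have hden : 1 / 2 ≤ ‖1 - v * (q : ℂ) ^ (-(1 : ℂ))‖ := by
    have h := norm_sub_norm_le (1 : ℂ) (v * (q : ℂ) ^ (-(1 : ℂ)))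
    rw [norm_one, norm_mul, hb] at h
    nlinarith [norm_nonneg v]
  have hden0 : 1 - v * (q : ℂ) ^ (-(1 : ℂ)) ≠ 0 := by
    intro h; rw [h, norm_zero] at hden; linarith
  rw [hsplit, div_sub_one hden0, norm_div,
    show 1 - v * ((q : ℂ) ^ (-(1 : ℂ)) * w₁) - (1 - v * (q : ℂ) ^ (-(1 : ℂ))) = v * (q : ℂ) ^ (-(1 : ℂ)) * (1 - w₁) by ring,
    div_le_iff₀ (by linarith), norm_mul, norm_mul, hb, norm_sub_rev]
  calc ‖v‖ * (q : ℝ)⁻¹ * ‖w₁ - 1‖ ≤ 1 * (q : ℝ)⁻¹ * ‖w₁ - 1‖ := by gcongr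
    _ = (2 * ‖w₁ - 1‖ / q) * (1 / 2) := by rw [div_eq_mul_inv]; ring
    _ ≤ 2 * ‖w₁ - 1‖ / q * ‖1 - v * (q : ℂ) ^ (-(1 : ℂ))‖ := by
        exact mul_le_mul_of_nonneg_left hden (by positivity)

end RatioModel

/-! ## §4. The coefficients `c_e = ϖ₂ⱼ^loc(q^e)(ν∗χ)(q^e)` against the model coefficients -/

section CoeffModel

variable (c' : ℝ) {D : ℕ} (χ : DirichletCharacter ℂ D) (j : ℕ)

/-- `((q^i))^{β} = (q^{β})^i`. [folklore] -/
private theorem natCast_pow_cpow'' (q i : ℕ) (s : ℂ) : ((q ^ i : ℕ) : ℂ) ^ s = ((q : ℂ) ^ s) ^ i := by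
  induction i with
  | zero => simp
  | succ i ih => rw [pow_succ, Nat.cast_mul, Complex.natCast_mul_natCast_cpow, ih, pow_succ]

/-- The model denominator `1 − χ(q)/(q−1)` is non-zero (real `χ`, not `q = 2 ∧ χ(2) = 1`), and the model
ratio `ρ⁰` has norm `≤ 4`. [cite: Zhang2022LandauSiegel, §16 Lemma 16.1 p.92] -/
theorem model_ratio_bounds {v el : ℂ} {q : ℕ} (hq : q.Prime) (hv : v = 0 ∨ v = 1 ∨ v = -1)
    (h2 : q = 2 → v ≠ 1) (hel : ‖el‖ ≤ 1) :
    1 - 1 * (v / ((q : ℂ) - 1)) ≠ 0 ∧ ‖(1 - el * (v / ((q : ℂ) - 1))) / (1 - 1 * (v / ((q : ℂ) - 1)))‖ ≤ 4 := by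
  have hq2 : (2 : ℝ) ≤ q := by exact_mod_cast hq.two_le
  have hq1r : (q : ℝ) - 1 ≤ ‖(q : ℂ) - 1‖ := by
    have := norm_sub_norm_le (q : ℂ) 1; rw [Complex.norm_natCast, norm_one] at this; linarith
  have hvn : ‖v‖ ≤ 1 := by rcases hv with h | h | h <;> simp [h]
  -- lower bound `1/2 ≤ ‖1 − v/(q−1)‖`
  have hden : 1 / 2 ≤ ‖1 - 1 * (v / ((q : ℂ) - 1))‖ := by
    rw [one_mul]
    rcases hv with h | h | h
    · rw [h]; norm_num
    · have hq3 : (3 : ℝ) ≤ q := by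
        have hne : q ≠ 2 := fun h' => h2 h' h
        have := hq.two_le
        exact_mod_cast (show 3 ≤ q by omega)
      have hvq : ‖v / ((q : ℂ) - 1)‖ ≤ 1 / 2 := by
        rw [norm_div, h, norm_one, div_le_iff₀ (by linarith)]; linarith
      have := norm_sub_norm_le (1 : ℂ) (v / ((q : ℂ) - 1)); rw [norm_one] at this; linarith
    · rw [h, show (1 : ℂ) - -1 / ((q : ℂ) - 1) = 1 + 1 / ((q : ℂ) - 1) by ring]
      have hq1 : (q : ℂ) - 1 ≠ 0 := by
        intro h0; have := congrArg Complex.re h0; simp at this; linarith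
      have e : (1 : ℂ) + 1 / ((q : ℂ) - 1) = (((q : ℝ) / (q - 1) : ℝ) : ℂ) := by
        push_cast; field_simp; ring
      rw [e, Complex.norm_real, Real.norm_eq_abs, abs_of_nonneg (div_nonneg (by linarith) (by linarith)),
        le_div_iff₀ (by linarith)]
      linarith
  refine ⟨fun h => by rw [h, norm_zero] at hden; linarith, ?_⟩
  have hnum : ‖1 - el * (v / ((q : ℂ) - 1))‖ ≤ 2 := by
    calc _ ≤ ‖(1 : ℂ)‖ + ‖el * (v / ((q : ℂ) - 1))‖ := norm_sub_le _ _
      _ ≤ 1 + 1 := by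
          rw [norm_one, norm_mul, norm_div]
          gcongr
          calc ‖el‖ * (‖v‖ / ‖(q : ℂ) - 1‖) ≤ 1 * (1 / 1) := by gcongr; linarith
            _ = 1 := by norm_num
      _ = 2 := by norm_num
  rw [norm_div, div_le_iff₀ (by linarith)]
  linarith

/-- **The coefficient `c_e = ϖ₂ⱼ^loc(q^e)(ν∗χ)(q^e)` against its `β → 0` model**
`c⁰_e = (Σ_{i≤e} χ(q)^{e−i}ρ⁰(q^{e−i}))·(ν∗χ)(q^e)`: `‖c_e − c⁰_e‖ ≤ 111400·(e+1)⁴·δ_q`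
(each of the `e+1` terms: `|λ₂ − 1| ≤ δ`, `|q^{iβ_j} − 1| ≤ eδ`, `|ρ − ρ⁰| ≤ 110000δ`, `|ρ| ≤ 700`; `|(ν∗χ)(q^e)| ≤ (e+1)²`).
[cite: Zhang2022LandauSiegel, §16 p.93, App. A p.106] -/
theorem norm_coeff_sub_model_le {q : ℕ} (hq : q.Prime)
    (hv : χ (q : ZMod D) = 0 ∨ χ (q : ZMod D) = 1 ∨ χ (q : ZMod D) = -1) (h2 : q = 2 → χ (2 : ZMod D) ≠ 1)
    (hF : 1 / 2 ≤ ‖calM2Factor c' χ q 1 1 (1 - betaJ c' D j)‖) (e : ℕ) :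
    ‖varpi2loc c' χ j (q ^ e) * nuConvChi χ (q ^ e) -
        (∑ i ∈ Finset.range (e + 1), χ (q : ZMod D) ^ (e - i) *
          ((1 - (if Nat.Coprime q (q ^ (e - i)) then (1 : ℂ) else 0) * (χ (q : ZMod D) / ((q : ℂ) - 1))) /
            (1 - 1 * (χ (q : ZMod D) / ((q : ℂ) - 1))))) * nuConvChi χ (q ^ e)‖
      ≤ 111400 * ((e : ℝ) + 1) ^ 4 * (‖(q : ℂ) ^ (-beta1 c' D) - 1‖ + ‖(q : ℂ) ^ betaJ c' D j - 1‖) := by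
  set v : ℂ := χ (q : ZMod D) with hvdef
  set δ : ℝ := ‖(q : ℂ) ^ (-beta1 c' D) - 1‖ + ‖(q : ℂ) ^ betaJ c' D j - 1‖ with hδ
  have hδ0 : 0 ≤ δ := by positivity
  have hq2 : (2 : ℝ) ≤ q := by exact_mod_cast hq.two_le
  have hq0 : (0 : ℝ) < q := by linarith
  have hvn : ‖v‖ ≤ 1 := χ.norm_le_one _
  have h2' : q = 2 → v ≠ 1 := by intro h; rw [hvdef, h]; simpa using h2 h
  have hs : 9 / 10 ≤ (1 - betaJ c' D j).re := by rw [one_sub_betaJ_re]; norm_num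
  -- the model ratio
  set ρ0 : ℕ → ℂ := fun i => (1 - (if Nat.Coprime q (q ^ (e - i)) then (1 : ℂ) else 0) * (v / ((q : ℂ) - 1))) /
    (1 - 1 * (v / ((q : ℂ) - 1))) with hρ0
  have hρ0n : ∀ i, ‖ρ0 i‖ ≤ 4 := fun i =>
    (model_ratio_bounds (el := (if Nat.Coprime q (q ^ (e - i)) then (1 : ℂ) else 0)) hq hv h2'
      (by split_ifs <;> simp)).2
  obtain ⟨hM0, -⟩ := model_ratio_bounds (el := 1) hq hv h2' (by simp)
  rcases Nat.eq_zero_or_pos e with rfl | he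
  · -- `e = 0`: both sides are `1`
    rw [pow_zero, varpi2loc_one, nuConvChi_one, Finset.sum_range_one]
    simp only [Nat.sub_self, pow_zero, Nat.coprime_one_right_eq_true, if_true, one_mul, mul_one]
    rw [one_mul] at hM0
    rw [div_self hM0, sub_self, norm_zero]
    positivity
  -- `e ≥ 1`
  rw [varpi2loc_prime_pow c' χ hq he.ne' j, ← sub_mul, ← Finset.sum_sub_distrib, norm_mul]
  have hterm : ∀ i ∈ Finset.range (e + 1),
      ‖lam2 c' χ (q ^ i) 1 * ((q ^ i : ℕ) : ℂ) ^ betaJ c' D j * v ^ (e - i) *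
            locRatio c' χ q (q ^ i) (q ^ (e - i)) (1 - betaJ c' D j) - v ^ (e - i) * ρ0 i‖
        ≤ 111400 * ((e : ℝ) + 1) * δ := by
    intro i hi
    have hi' : i ≤ e := Nat.lt_succ_iff.mp (Finset.mem_range.mp hi)
    set wi : ℂ := ((q ^ i : ℕ) : ℂ) ^ betaJ c' D j with hwi
    set li : ℂ := lam2 c' χ (q ^ i) 1 with hli
    set ρi : ℂ := locRatio c' χ q (q ^ i) (q ^ (e - i)) (1 - betaJ c' D j) with hρi
    have hwin : ‖wi‖ = 1 := norm_prime_pow_cpow_betaJ c' (D := D) hq i j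
    have hwi1 : ‖wi - 1‖ ≤ e * δ := by
      rw [hwi, natCast_pow_cpow'']
      have hw : ‖(q : ℂ) ^ betaJ c' D j‖ ≤ 1 := by
        rw [Complex.norm_natCast_cpow_of_pos hq.pos, betaJ_re_eq_zero, Real.rpow_zero]
      have hie : (i : ℝ) ≤ e := by exact_mod_cast hi'
      have hwδ : ‖(q : ℂ) ^ betaJ c' D j - 1‖ ≤ δ := by
        rw [hδ]; linarith [norm_nonneg ((q : ℂ) ^ (-beta1 c' D) - 1)]
      calc _ ≤ (i : ℝ) * ‖(q : ℂ) ^ betaJ c' D j - 1‖ := norm_pow_sub_one_le hw i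
        _ ≤ e * δ := mul_le_mul hie hwδ (norm_nonneg _) (Nat.cast_nonneg e)
    have hli1 : ‖li - 1‖ ≤ δ := by
      rw [hli, lam2_prime_pow c' χ hq i]
      split_ifs
      · simp; exact hδ0
      · calc _ ≤ 2 * ‖(q : ℂ) ^ (-beta1 c' D) - 1‖ / q := norm_lam2_one_sub_one_le' c' χ hq
          _ ≤ 2 * ‖(q : ℂ) ^ (-beta1 c' D) - 1‖ / 2 := by gcongr
          _ ≤ δ := by rw [hδ]; linarith [norm_nonneg ((q : ℂ) ^ betaJ c' D j - 1)]
    have hρin : ‖ρi‖ ≤ 700 := by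
      rw [hρi]; unfold locRatio
      rw [norm_div, div_le_iff₀ (by linarith)]
      calc _ ≤ (350 : ℝ) := norm_calM2Factor_le c' χ hq _ _ hs
        _ ≤ 700 * ‖calM2Factor c' χ q 1 1 (1 - betaJ c' D j)‖ := by linarith
    have hρi0 : ‖ρi - ρ0 i‖ ≤ 110000 * δ := norm_locRatio_sub_model_le c' χ j hq hv h2 hF (q ^ i) (q ^ (e - i))
    have hvpow : ‖v ^ (e - i)‖ ≤ 1 := by rw [norm_pow]; exact pow_le_one₀ (norm_nonneg _) hvn
    rw [show li * wi * v ^ (e - i) * ρi - v ^ (e - i) * ρ0 i =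
      v ^ (e - i) * ((li - 1) * wi * ρi + (wi - 1) * ρi + (ρi - ρ0 i)) by ring, norm_mul]
    calc ‖v ^ (e - i)‖ * ‖(li - 1) * wi * ρi + (wi - 1) * ρi + (ρi - ρ0 i)‖
        ≤ 1 * (‖li - 1‖ * ‖wi‖ * ‖ρi‖ + ‖wi - 1‖ * ‖ρi‖ + ‖ρi - ρ0 i‖) := by
          gcongr
          calc _ ≤ ‖(li - 1) * wi * ρi + (wi - 1) * ρi‖ + ‖ρi - ρ0 i‖ := norm_add_le _ _
            _ ≤ (‖(li - 1) * wi * ρi‖ + ‖(wi - 1) * ρi‖) + ‖ρi - ρ0 i‖ := by gcongr; exact norm_add_le _ _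
            _ = _ := by rw [norm_mul, norm_mul, norm_mul]
      _ ≤ 1 * (δ * 1 * 700 + (e * δ) * 700 + 110000 * δ) := by rw [hwin]; gcongr
      _ ≤ 111400 * ((e : ℝ) + 1) * δ := by nlinarith [Nat.cast_nonneg (α := ℝ) e]
  have hsum : ‖∑ i ∈ Finset.range (e + 1),
      (lam2 c' χ (q ^ i) 1 * ((q ^ i : ℕ) : ℂ) ^ betaJ c' D j * v ^ (e - i) *
          locRatio c' χ q (q ^ i) (q ^ (e - i)) (1 - betaJ c' D j) - v ^ (e - i) * ρ0 i)‖
        ≤ (e + 1) * (111400 * ((e : ℝ) + 1) * δ) := by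
    calc _ ≤ ∑ i ∈ Finset.range (e + 1), ‖lam2 c' χ (q ^ i) 1 * ((q ^ i : ℕ) : ℂ) ^ betaJ c' D j * v ^ (e - i) *
          locRatio c' χ q (q ^ i) (q ^ (e - i)) (1 - betaJ c' D j) - v ^ (e - i) * ρ0 i‖ := norm_sum_le _ _
      _ ≤ ∑ i ∈ Finset.range (e + 1), 111400 * ((e : ℝ) + 1) * δ := Finset.sum_le_sum hterm
      _ = (e + 1) * (111400 * ((e : ℝ) + 1) * δ) := by simp
  have ha := norm_nuConvChi_prime_pow_le χ hq e
  calc _ ≤ ((e + 1) * (111400 * ((e : ℝ) + 1) * δ)) * (((e : ℝ) + 1) ^ 2) :=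
        mul_le_mul hsum ha (norm_nonneg _) (by positivity)
    _ = 111400 * ((e : ℝ) + 1) ^ 4 * δ := by ring

end CoeffModel

end Literature.NumberTheory.LFunctions.Zhang2022.Lemma162R

end
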